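import Summits.HodgeConjecture.HodgeConjecture.Theorems.F0P3AdmissibleUnitaryComplement      -- (U♮) ★ p821397: complements, `mem_fixedPoints_of_add_eq`
import Summits.HodgeConjecture.HodgeConjecture.Theorems.F0P3SphericalConstituentOfUnitary    -- ★ p821632: `span_translates_stable`
import Summits.HodgeConjecture.HodgeConjecture.Theorems.F0P3FinComponentAdmissible          -- ★ (A4c) §1: `isAdmissible_of_injective_equivariant`
import HarnessLib

/-!
# Crux `H413` — rung 4, row #22 pay-down, generic half: an inner-product preserving representation generated by a SMOOTH vector with admissible span
# has an IRREDUCIBLE admissible sub-representation — the span of a MINIMAL block of `K`-fixed vectors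
# (Bernstein–Zelevinsky 1976 §2.3; Bump 1997 Prop. 4.2.3; Casselman 1995 §2.1)

Floor-0 programme P3 «U3-mult», seat B-p08 (g20); crux item stmt-HodgeConjecture-24833 (`HCCMUnconditional.H413`); B-p08 OFFER 12:14Z on PLAN.F0P3g5 row #22
(L7″) `LocalIsotypyFin` ∕ «AFA» (`AutomorphicFlathAdmissible`, ★ p822536) ON THE COTANGENT LOCUS.  PROOF lane (`--supports stmt-HodgeConjecture-24833 --as helper`):
theorems only — no `def`, no named fact, no instance, no notation, no `sorry`.  GENERIC (any topological group `G` with a compact open subgroup; no automorphic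
object); the GLOBAL twin of the local «RC» engine ★ `F0P3SphericalConstituentOfUnitary` (there: `(G, K)` a Gelfand pair and the block is a Hecke LINE; here: no
Gelfand pair, the block is a minimal `K`-fixed sub-block).  HONEST LABEL: HC_CM is proved only modulo the printed citations until rung 0 closes; this file
discharges none of them.

* §1 `isIrreducible_of_fixedPoints_minimal` — `ρ` ADMISSIBLE, inner-product preserving: if `V^K ≠ 0` generates `V` and every sub-representation `N` has
  `N ⊓ V^K = 0` or `V^K ≤ N`, then `ρ` is irreducible ((U♮): `N ⊓ V^K = 0 ⇒ V^K ≤ Nᗮ ⇒ Nᗮ = V ⇒ N = 0`).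
* §2 `exists_irreducible_subrepresentation_of_isSmoothVector` — `ρ` inner-product preserving on the pre-Hilbert `V` (not necessarily smooth), `S ≤ V` stable,
  consisting of smooth vectors, with `S ⊓ V^{K′}` finite-dimensional for all compact open `K′`, `0 ≠ x₀ ∈ S ∩ V^K`: among the sub-representations `N ≤ S` with
  `N ⊓ V^K ≠ 0` take `dim (N ⊓ V^K)` minimal and `N₀ := ℂ[G]·(N ⊓ V^K)`; then `N₀ ≤ S` is IRREDUCIBLE (§1), smooth, admissible, inner-product preserving, `N₀^K ≠ 0`.

References: [BernsteinZelevinsky1976] I. N. Bernstein, A. V. Zelevinsky, Russian Math. Surveys 31:3 (1976), §2.1–2.3; [Bump1997] D. Bump, *Automorphic forms and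
representations* (1997), §4.2 Prop. 4.2.3; [Casselman1995] W. Casselman, *Introduction to the theory of admissible representations of p-adic reductive groups*
(1995 notes), §2.1; [BushnellHenniart2006] §2, §11.1.
-/

set_option autoImplicit false
set_option linter.dupNamespace false

noncomputable section

open scoped InnerProductSpace
open Summit.HodgeConjecture.HodgeConjecture.Cruxes.H413.F0P3AdmissibleUnitaryComplement
open Summit.HodgeConjecture.HodgeConjecture.Cruxes.H413.F0P3SphericalConstituentOfUnitary (span_translates_stable)

namespace Summit.HodgeConjecture.HodgeConjecture.Cruxes.H413.F0P3IrreducibleConstituentOfUnitary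

variable {G : Type*} [Group G] [TopologicalSpace G] [IsTopologicalGroup G]
  {V : Type} [NormedAddCommGroup V] [InnerProductSpace ℂ V] {ρ : Representation ℂ G V}

/-! ## §1 Irreducibility from a minimal generating block of `K`-fixed vectors -/

/-- **IRREDUCIBILITY CRITERION.**  `ρ` admissible and inner-product preserving on the pre-Hilbert space `V` (`G` with a compact open subgroup `K₀`); `V^K ≠ 0`
GENERATES `V` (every sub-representation containing `V^K` is `⊤`) and is MINIMAL (every sub-representation `N` has `N ⊓ V^K = ⊥` or contains `V^K`).  Then `ρ` is
irreducible: in the first case `V^K ≤ Nᗮ` (decompose `e = u + u′` along `V = N ⊕ Nᗮ`, ★ (U♮) `exists_mem_add_mem_orthogonal`; `u ∈ N ⊓ V^K = 0` by ★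
`mem_fixedPoints_of_add_eq`), so `Nᗮ = ⊤` and `N = N ⊓ Nᗮ = ⊥`. [cite: BernsteinZelevinsky1976, §2.3] [cite: Bump1997, §4.2 Prop. 4.2.3] [cite: Casselman1995, §2.1] -/
theorem isIrreducible_of_fixedPoints_minimal (hU : ∀ (g : G) (x y : V), ⟪ρ g x, ρ g y⟫_ℂ = ⟪x, y⟫_ℂ) (hadm : ρ.IsAdmissible)
    {K₀ : Subgroup G} (hK₀o : IsOpen (K₀ : Set G)) (hK₀c : IsCompact (K₀ : Set G)) {K : Subgroup G}
    (hne : ρ.fixedPoints K ≠ ⊥) (hgen : ∀ N : Subrepresentation ρ, ρ.fixedPoints K ≤ N.toSubmodule → N = ⊤)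
    (hmin : ∀ N : Subrepresentation ρ, N.toSubmodule ⊓ ρ.fixedPoints K = ⊥ ∨ ρ.fixedPoints K ≤ N.toSubmodule) : ρ.IsIrreducible := by
  obtain ⟨e, heK, he0⟩ := (Submodule.ne_bot_iff _).1 hne
  haveI : Nontrivial (Subrepresentation ρ) := ⟨⟨⊥, ⊤, fun h => he0 ?_⟩⟩
  swap
  · have h' := congrArg Subrepresentation.toSubmodule h
    rw [(toSubmodule_bot_top ρ).1, (toSubmodule_bot_top ρ).2] at h'
    have : e ∈ (⊥ : Submodule ℂ V) := h' ▸ Submodule.mem_top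
    exact (Submodule.mem_bot ℂ).1 this
  refine { eq_bot_or_eq_top := fun N => ?_ }
  rcases hmin N with h0 | hle
  · -- `N ⊓ V^K = ⊥`: `V^K ≤ Nᗮ`, so `Nᗮ = ⊤` and `N = ⊥`
    left
    let Nc : Subrepresentation ρ := ⟨N.toSubmoduleᗮ, fun g x hx => apply_mem_orthogonal hU N g hx⟩
    have hKle : ρ.fixedPoints K ≤ Nc.toSubmodule := by
      intro f hf
      obtain ⟨u, hu, u', hu', hfu⟩ := exists_mem_add_mem_orthogonal hU hadm hK₀o hK₀c N f
      have huK : u ∈ ρ.fixedPoints K := mem_fixedPoints_of_add_eq hU N hf hu hu' hfu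
      have hu0 : u = 0 := by
        have : u ∈ N.toSubmodule ⊓ ρ.fixedPoints K := Submodule.mem_inf.2 ⟨hu, huK⟩
        rwa [h0, Submodule.mem_bot] at this
      rw [hfu, hu0, zero_add]
      exact hu'
    have hNc : Nc = ⊤ := hgen Nc hKle
    have hNc' : N.toSubmoduleᗮ = ⊤ := by
      have h := congrArg Subrepresentation.toSubmodule hNc
      rw [(toSubmodule_bot_top ρ).2] at h
      exact h
    apply Subrepresentation.toSubmodule_injective
    rw [(toSubmodule_bot_top ρ).1, eq_bot_iff]
    intro x hx
    have hx' : x ∈ N.toSubmodule ⊓ N.toSubmoduleᗮ := Submodule.mem_inf.2 ⟨hx, hNc' ▸ Submodule.mem_top⟩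
    rwa [Submodule.inf_orthogonal_eq_bot] at hx'
  · right
    exact hgen N hle

/-! ## §2 The irreducible sub-representation inside the span of a smooth vector: a minimal block of `K`-fixed vectors -/

omit [TopologicalSpace G] [IsTopologicalGroup G] [NormedAddCommGroup V] [InnerProductSpace ℂ V] in
/-- The span of the `G`-translates of a SET `F` is `ρ`-stable. [cite: BushnellHenniart2006, §2] -/
theorem span_translates_set_stable {V : Type*} [AddCommGroup V] [Module ℂ V] {ρ : Representation ℂ G V} (F : Set V) (g : G) {x : V}
    (hx : x ∈ Submodule.span ℂ (Set.range fun p : G × F => ρ p.1 (p.2 : V))) :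
    ρ g x ∈ Submodule.span ℂ (Set.range fun p : G × F => ρ p.1 (p.2 : V)) := by
  have h : (Submodule.span ℂ (Set.range fun p : G × F => ρ p.1 (p.2 : V))).map (ρ g) ≤
      Submodule.span ℂ (Set.range fun p : G × F => ρ p.1 (p.2 : V)) := by
    rw [Submodule.map_span, Submodule.span_le]
    rintro _ ⟨_, ⟨p, rfl⟩, rfl⟩
    exact Submodule.subset_span ⟨⟨g * p.1, p.2⟩, by simp only [map_mul, Module.End.mul_apply]⟩
  exact h ⟨x, hx, rfl⟩

/-- **THE IRREDUCIBLE SUB-REPRESENTATION FROM A SMOOTH VECTOR (no Gelfand pair).**  `ρ` inner-product preserving on the pre-Hilbert `V`; `S ≤ V` stable, made of SMOOTH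
vectors, with `S ⊓ V^{K′}` finite-dimensional for every compact open `K′`; `K` compact open and `0 ≠ x₀ ∈ S ∩ V^K`.  Then some sub-representation `N₁ ≤ S` is
IRREDUCIBLE, smooth, admissible, inner-product preserving, with `N₁^K ≠ 0`: among the sub-representations `N ≤ S` with `N ⊓ V^K ≠ 0` choose `dim (N ⊓ V^K)` MINIMAL
(`Nat.find`) and take `N₁ := ℂ[G]·(N ⊓ V^K)`; §1 applies to `N₁` (generation by construction, minimality by the choice, admissibility ★ `isAdmissible_of_injective_equivariant`).
[cite: BernsteinZelevinsky1976, §2.1–2.3] [cite: Bump1997, §4.2 Prop. 4.2.3] [cite: Casselman1995, §2.1] -/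
theorem exists_irreducible_subrepresentation_of_isSmoothVector (hU : ∀ (g : G) (x y : V), ⟪ρ g x, ρ g y⟫_ℂ = ⟪x, y⟫_ℂ)
    {K : Subgroup G} (hKo : IsOpen (K : Set G)) (hKc : IsCompact (K : Set G))
    (S : Submodule ℂ V) (hS : ∀ (g : G) (x : V), x ∈ S → ρ g x ∈ S) (hSsm : ∀ x ∈ S, ρ.IsSmoothVector x)
    (hSfin : ∀ K' : Subgroup G, IsOpen (K' : Set G) → IsCompact (K' : Set G) → FiniteDimensional ℂ ↥(S ⊓ ρ.fixedPoints K'))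
    {x₀ : V} (hx₀0 : x₀ ≠ 0) (hx₀K : x₀ ∈ ρ.fixedPoints K) (hx₀S : x₀ ∈ S) :
    ∃ N₁ : Subrepresentation ρ, N₁.toSubmodule ≤ S ∧ N₁.toRepresentation.IsIrreducible ∧ N₁.toRepresentation.IsSmooth ∧
      N₁.toRepresentation.IsAdmissible ∧
      (∀ (g : G) (x y : ↥N₁.toSubmodule), ⟪N₁.toRepresentation g x, N₁.toRepresentation g y⟫_ℂ = ⟪x, y⟫_ℂ) ∧
      N₁.toRepresentation.fixedPoints K ≠ ⊥ := by
  classical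
  -- admissible sub-representations `N ≤ S` with `N ⊓ V^K ≠ ⊥`, and the minimal dimension `n₀` of `N ⊓ V^K` among them
  let good : Subrepresentation ρ → Prop := fun N => N.toSubmodule ≤ S ∧ N.toSubmodule ⊓ ρ.fixedPoints K ≠ ⊥
  have hex : ∃ n : ℕ, ∃ N : Subrepresentation ρ, good N ∧ Module.finrank ℂ ↥(N.toSubmodule ⊓ ρ.fixedPoints K) = n :=
    ⟨_, ⟨S, hS⟩, ⟨le_rfl, (Submodule.ne_bot_iff _).2 ⟨x₀, Submodule.mem_inf.2 ⟨hx₀S, hx₀K⟩, hx₀0⟩⟩, rfl⟩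
  obtain ⟨N, ⟨hNS, hNK⟩, hNn⟩ := Nat.find_spec hex
  have hmin : ∀ M : Subrepresentation ρ, good M → Module.finrank ℂ ↥(N.toSubmodule ⊓ ρ.fixedPoints K) ≤
      Module.finrank ℂ ↥(M.toSubmodule ⊓ ρ.fixedPoints K) := fun M hM => by
    rw [hNn]
    exact Nat.find_min' hex ⟨M, hM, rfl⟩
  -- the block `F := N ⊓ V^K` (finite-dimensional) and `N₁ := ℂ[G]·F`
  set F : Submodule ℂ V := N.toSubmodule ⊓ ρ.fixedPoints K with hFdef
  haveI hFfin : FiniteDimensional ℂ ↥F := by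
    haveI := hSfin K hKo hKc
    exact Submodule.finiteDimensional_of_le (inf_le_inf_right _ hNS)
  let N₁ : Subrepresentation ρ := ⟨Submodule.span ℂ (Set.range fun p : G × (F : Set V) => ρ p.1 (p.2 : V)),
    fun g x hx => span_translates_set_stable (ρ := ρ) (F : Set V) g hx⟩
  have hN₁def : N₁.toSubmodule = Submodule.span ℂ (Set.range fun p : G × (F : Set V) => ρ p.1 (p.2 : V)) := rfl
  have hFN₁ : F ≤ N₁.toSubmodule := fun f hf =>
    Submodule.subset_span ⟨⟨1, ⟨f, hf⟩⟩, by simp only [map_one, Module.End.one_apply]⟩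
  have hN₁N : N₁.toSubmodule ≤ N.toSubmodule := by
    rw [hN₁def, Submodule.span_le]
    rintro _ ⟨p, rfl⟩
    exact N.apply_mem_toSubmodule p.1 (Submodule.mem_inf.1 p.2.2).1
  have hN₁S : N₁.toSubmodule ≤ S := hN₁N.trans hNS
  have hN₁F : N₁.toSubmodule ⊓ ρ.fixedPoints K = F :=
    le_antisymm (fun x hx => Submodule.mem_inf.2 ⟨hN₁N (Submodule.mem_inf.1 hx).1, (Submodule.mem_inf.1 hx).2⟩)
      (fun x hx => Submodule.mem_inf.2 ⟨hFN₁ hx, (Submodule.mem_inf.1 hx).2⟩)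
  -- the representation `σ` on `N₁`
  have hσ_apply : ∀ (g : G) (x : ↥N₁.toSubmodule), ((N₁.toRepresentation g x : ↥N₁.toSubmodule) : V) = ρ g (x : V) := fun g x => rfl
  have hσsm : N₁.toRepresentation.IsSmooth := fun x => by
    have heq : (N₁.toRepresentation.stabilizerSubgroup x : Set G) = (ρ.stabilizerSubgroup (x : V) : Set G) := by
      ext g
      simp only [SetLike.mem_coe, Representation.mem_stabilizerSubgroup, Subtype.ext_iff, hσ_apply]
    change IsOpen (N₁.toRepresentation.stabilizerSubgroup x : Set G)
    rw [heq]
    exact hSsm _ (hN₁S x.2)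
  have hσU : ∀ (g : G) (x y : ↥N₁.toSubmodule), ⟪N₁.toRepresentation g x, N₁.toRepresentation g y⟫_ℂ = ⟪x, y⟫_ℂ := by
    intro g x y
    rw [Submodule.coe_inner, Submodule.coe_inner, hσ_apply, hσ_apply]
    exact hU g _ _
  have hσadm : N₁.toRepresentation.IsAdmissible :=
    F0P3FinComponentAdmissible.isAdmissible_of_injective_equivariant hσsm (ρ := ρ) N₁.toSubmodule.subtype
      (fun b w => by rw [Submodule.subtype_apply, Submodule.subtype_apply, hσ_apply]) Subtype.val_injective S (fun w => hN₁S w.2) hSfin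
  -- `K`-fixed vectors of `σ` ↔ `K`-fixed vectors of `ρ` in `N₁`
  have hfixK : ∀ z : ↥N₁.toSubmodule, z ∈ N₁.toRepresentation.fixedPoints K ↔ (z : V) ∈ ρ.fixedPoints K := fun z => by
    rw [Representation.mem_fixedPoints, Representation.mem_fixedPoints]
    exact ⟨fun h u hu => by rw [← hσ_apply]; exact congrArg Subtype.val (h u hu), fun h u hu => Subtype.ext (h u hu)⟩
  -- §1 on `σ`: `σ^K ≠ ⊥`
  have hne : N₁.toRepresentation.fixedPoints K ≠ ⊥ := by
    obtain ⟨f, hf, hf0⟩ := (Submodule.ne_bot_iff _).1 hNK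
    refine (Submodule.ne_bot_iff _).2 ⟨⟨f, hFN₁ hf⟩, (hfixK _).2 (Submodule.mem_inf.1 hf).2, fun h => hf0 (congrArg Subtype.val h)⟩
  -- generation: a sub-representation of `σ` containing `σ^K` contains `F`, hence all of `N₁ = ℂ[G]·F`
  have hgen : ∀ N' : Subrepresentation N₁.toRepresentation, N₁.toRepresentation.fixedPoints K ≤ N'.toSubmodule → N' = ⊤ := by
    intro N' hN'
    apply Subrepresentation.toSubmodule_injective
    rw [(toSubmodule_bot_top _).2, eq_top_iff]
    rintro ⟨x, hx⟩ -
    have hx' := hx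
    rw [hN₁def] at hx'
    -- induction over the span
    refine Submodule.span_induction (p := fun y hy => (⟨y, hN₁def ▸ hy⟩ : ↥N₁.toSubmodule) ∈ N'.toSubmodule) ?_ ?_ ?_ ?_ hx'
    · rintro _ ⟨p, rfl⟩
      have hpF : (⟨(p.2 : V), hFN₁ p.2.2⟩ : ↥N₁.toSubmodule) ∈ N'.toSubmodule :=
        hN' ((hfixK _).2 (Submodule.mem_inf.1 p.2.2).2)
      have h := N'.apply_mem_toSubmodule p.1 hpF
      exact h
    · exact N'.toSubmodule.zero_mem
    · intro y z _ _ hy hz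
      exact N'.toSubmodule.add_mem hy hz
    · intro c y _ hy
      exact N'.toSubmodule.smul_mem c hy
  -- minimality: a sub-representation `N'` of `σ` with a non-zero `K`-fixed vector contains `σ^K` (its image in `V` is `good`, of fixed dimension `≤ dim F`)
  have hmin' : ∀ N' : Subrepresentation N₁.toRepresentation,
      N'.toSubmodule ⊓ N₁.toRepresentation.fixedPoints K = ⊥ ∨ N₁.toRepresentation.fixedPoints K ≤ N'.toSubmodule := by
    intro N'
    by_cases h0 : N'.toSubmodule ⊓ N₁.toRepresentation.fixedPoints K = ⊥
    · exact Or.inl h0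
    right
    -- the image `M` of `N'` in `V`
    let M : Subrepresentation ρ := ⟨N'.toSubmodule.map N₁.toSubmodule.subtype, fun g x hx => by
      obtain ⟨y, hy, rfl⟩ := hx
      exact ⟨N₁.toRepresentation g y, N'.apply_mem_toSubmodule g hy, rfl⟩⟩
    have hMdef : M.toSubmodule = N'.toSubmodule.map N₁.toSubmodule.subtype := rfl
    have hMN₁ : M.toSubmodule ≤ N₁.toSubmodule := by
      rw [hMdef]; rintro _ ⟨y, _, rfl⟩; exact y.2
    have hMF : M.toSubmodule ⊓ ρ.fixedPoints K ≤ F := hN₁F ▸ inf_le_inf_right _ hMN₁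
    have hMgood : good M := by
      refine ⟨hMN₁.trans hN₁S, ?_⟩
      obtain ⟨z, hz, hz0⟩ := (Submodule.ne_bot_iff _).1 h0
      refine (Submodule.ne_bot_iff _).2 ⟨(z : V), Submodule.mem_inf.2 ⟨⟨z, (Submodule.mem_inf.1 hz).1, rfl⟩,
        (hfixK z).1 (Submodule.mem_inf.1 hz).2⟩, fun h => hz0 (Subtype.ext h)⟩
    have hdim := hmin M hMgood
    have hMFeq : M.toSubmodule ⊓ ρ.fixedPoints K = F :=
      Submodule.eq_of_le_of_finrank_le hMF (by rw [hFdef]; exact hdim)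
    -- hence `σ^K ≤ N'`
    intro z hz
    have hzF : (z : V) ∈ F := by rw [← hN₁F]; exact Submodule.mem_inf.2 ⟨z.2, (hfixK z).1 hz⟩
    rw [← hMFeq] at hzF
    obtain ⟨y, hy, hyz⟩ := (Submodule.mem_inf.1 hzF).1
    have : y = z := Subtype.ext hyz
    exact this ▸ hy
  have hirr : N₁.toRepresentation.IsIrreducible := isIrreducible_of_fixedPoints_minimal hσU hσadm hKo hKc hne hgen hmin'
  exact ⟨N₁, hN₁S, hirr, hσsm, hσadm, hσU, hne⟩

end Summit.HodgeConjecture.HodgeConjecture.Cruxes.H413.F0P3IrreducibleConstituentOfUnitary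

end
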